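import Mathlib
import HarnessLib
import HarnessLib.Audit
import Summits.Langlands.Statement
import Summits.Langlands.Langlands.Theses.CoreAdequacySplit
import Summits.Langlands.Langlands.Theorems.CoreAdequacySplit
import Summits.Langlands.Langlands.Theorems.BrightMateBypass
import Summits.Langlands.Langlands.Theses.LieDefectSplit
import Summits.Langlands.Langlands.Theses.OdlyzkoWorldSplit
import Summits.Langlands.Langlands.Theorems.LieDefectSplit
import Literature.NumberTheory.GaloisRepresentations.ResidualGaloisRep
import Literature.NumberTheory.GaloisRepresentations.AdequateSubgroup
import Literature.NumberTheory.GaloisRepresentations.ExtendedAdequateSubgroup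
import Summits.Langlands.Langlands.Theses.ExtendedAdequacySplit

/-! # birth skeleton (BC3) of XS = `ExtendedAdequacySplit.ExtendedAdequateLayerLifting` + the BC5 PLAN-ONLY rung.
POST-BIRTH form (use THIS file for `ledger crux write … Lines/birth.lean` + `ledger skeleton check`): imports the born route file and concludes the route decl BY NAME
(`ExtendedAdequateLayerLifting_proof`; operator INBOX 2026-08-30T22:10:41Z skeleton.missing lesson).  Split by BASE FIELD × RANK into the two
sectors that carry an engine and the rest: (1) totally real K, n ≤ 2 — with ℓ ≤ n this is exactly the DYADIC GL₂ sector (2,2), and XS ∩ (2,2) =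
the INSOLUBLE-image dyadic representations (an extended-adequate absolutely irreducible layer above the perfect core P forces P ≠ 1; conversely an
insoluble absolutely irreducible subgroup of GL₂(𝔽̄₂) has perfect core SL₂(2^r), r ≥ 2, extended-adequate on the natural module by GHT17 Cor 9.4
[corpus:paper:arxiv-1405.0043 p34: exceptions only (p^r, dim) ∈ {(2,2),(3,3),(4,4)}, p^r = 9 with dim 3,6,9, r = 1 dim (p±1)/2]) = the hypothesis
(iii) «non-soluble image» of Thorne Math. Z. 2017 Thm 1.2 (= Thm 6.1) / Kisin 2009 (Invent. 178) — the BC5 RUNG; (2) K imaginary CM — the sector of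
the ENGINE Thorne 2017 Thm 5.1 (tree fact `Thorne2017.automorphyLifting_unitary_ordinaryMinimal`); (3) the rest (K neither CM nor [totally real with
n ≤ 2]) — reached in print only through a quadratic CM base change K·E/K (totally real K, n ≥ 3) and dark otherwise.  Every stub carries XS's
hypotheses verbatim (position ℓ ≤ n, dial SXADQ, DEG's carve literals); cells structured over the landed twins BY NAME.  sorries ONLY inside `stub_*`. -/

set_option linter.dupNamespace false

namespace Summit.Langlands.Langlands.Cruxes.ExtendedAdequateLayerLifting.Birth

open Filter

open Summit.Langlands.Langlands.Theses.ExtendedAdequacySplit (ExtendedAdequateLayerLifting)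

/-- BC5 PLAN-ONLY RUNG (tribunal T3, `T3-plan-only`) and first stub: XS on rank n ≤ 2 over a TOTALLY REAL K.  With ℓ ≤ n ≤ 2 the position is
(n, ℓ) = (2, 2) (n = 1 is vacuous: no prime ℓ ≤ 1), K(ζ₂) = K, and the dial SXADQ says: the image I of ρ̄ has an absolutely irreducible EXTENDED-adequate
layer above its perfect core P — so P ≠ 1, i.e. ρ̄ has INSOLUBLE image, and conversely (perfect core SL₂(2^r), r ≥ 2, extended-adequate on 𝔽̄₂² by
GHT17 Cor 9.4).  IN PRINT at parallel weight 2: Thorne, Math. Z. 285 (2017) Thm 1.2 = Thm 6.1 [corpus:paper:doi-10-1007-s00209-016-1681-2 p2]: F totally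
real, ρ : G_F → GL₂(ℚ̄₂) a.e. unramified, potentially crystalline at v ∣ 2 with HT_τ = {0,1}, absolutely irreducible with non-soluble image, ρ̄(c_v) ≠ 1
at some v ∣ ∞, residually automorphic (ρ̄ ≅ r̄_ι(π), π RAESDC) ⇒ ρ automorphic — improving Kisin, Invent. Math. 178 (2009) 587–634 «Modularity of 2-adic
Barsotti–Tate representations» [graph:doi:10.1007/s00222-009-0207-5] (Kisin needs 2 split / BT; Thorne's proof = Thm 5.1 at n = 4 via GL₂ × GL₂ tensor
functoriality, «induction from index 2 subgroups does not preserve adequacy»).  Residual automorphy is LiftTail's «linked to a weakly automorphic ρ'»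
hypothesis.  NOT in print as typed: other Hodge–Tate weights (no weight cycling at ℓ = 2), ρ̄(c_v) = 1 at all v ∣ ∞ (Dickinson's condition fails) — hence
PLAN-ONLY.  OUTSIDE S's known regime: Langlands for GL₂ over totally real fields is open (no Serre conjecture, no general-weight lifting at ℓ = 2), and the
rung is a lifting statement whose image hypothesis is EXACTLY the route's lever (extended adequacy ⟺ insoluble image at (2,2)) — it exercises XS, not
the residual CORE (which is EMPTY at (2,2)).  Technique: Thorne 2017 §6 (ordinary automorphic lifts by tensoring insoluble GL₂ residual representations,
Thm 5.1 at n = 4) on top of Kisin's 2-adic patching; general weight would need 2-adic Hida theory (Allen 2014 style) — named, not claimed.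
(critic row 184 c2: the dyadic GL₂ world is NAMED here as a rung, not re-cut as an item.) -/
theorem stub_rung_dyadicRank2_totallyReal : ∀ (K : Type) [Field K] [NumberField K] (n : ℕ) (hcpt : Literature.NumberTheory.Automorphic.isCompact_glFiniteIntegralLevel n K), 0 < n → Summit.Langlands.Langlands.Theorems.CoreAdequacy.LiftBelow n → ∀ (ℓ : ℕ) [Fact ℓ.Prime] (ι : PadicAlgCl ℓ ≃+* ℂ) (ρ : Literature.NumberTheory.GaloisRepresentations.FramedGaloisRep K (PadicAlgCl ℓ) n), ℓ < 2 * (n + 1) → NumberField.IsTotallyReal K → n ≤ 2 → Summit.Langlands.Langlands.Theorems.CoreAdequacy.CycIrr ρ → ¬ Summit.Langlands.Langlands.Theorems.CoreAdequacy.AdequateCyclotomicImage ρ → ¬ Summit.Langlands.Langlands.Theorems.CoreAdequacy.SolvablyAdequateImage ρ → ¬ Summit.Langlands.Langlands.Theorems.CoreAdequacy.LieDefect.SolvableDescentShadow ρ → ¬ Summit.Langlands.Langlands.Theorems.CoreAdequacy.LieDefect.SolvablyQuasiAdequateImage ρ → ℓ ≤ n → (∃ τ : Field.absoluteGaloisGroup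 (CyclotomicField ℓ K) →* Matrix.GeneralLinearGroup (Fin n) (Literature.NumberTheory.GaloisRepresentations.padicAlgClResidueField ℓ), (ρ.restrictField (CyclotomicField ℓ K)).IsReductionOf (RingHom.id (Literature.NumberTheory.GaloisRepresentations.padicAlgClResidueField ℓ)) τ ∧ Literature.NumberTheory.GaloisRepresentations.IsAbsIrreducible τ ∧ ∃ J : Subgroup (Matrix.GeneralLinearGroup (Fin n) (Literature.NumberTheory.GaloisRepresentations.padicAlgClResidueField ℓ)), Summit.Langlands.Langlands.Theorems.CoreAdequacy.LieDefect.AboveCore τ.range J ∧ J ≤ τ.range ∧ Literature.NumberTheory.GaloisRepresentations.IsAbsIrreducible J.subtype ∧ Literature.NumberTheory.GaloisRepresentations.Subgroup.IsExtendedAdequate J) → ¬ Summit.Langlands.Langlands.Theorems.BrightMate.SolvablyReducible ρ → ¬ Summit.Langlands.Langlands.Theorems.BrightMate.SolvablyMated ι ρ → Summit.Langlands.Langlands.Theorems.CoreAdequacy.LiftTail K n hcpt ℓ ι ρ := by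
  sorry

/-- ENGINE SECTOR stub: XS over an imaginary CM field K (`NumberField.IsCMField K`, Mathlib, a Prop class).  On instances that are POLARIZED
(ρ^c ≅ ρ^∨ε^{1−n}), crystalline-ORDINARY at v ∣ ℓ and MINIMAL relative to the linked automorphic ρ' (same local behaviour at every finite v), with
¬(ℓ = 2 ∧ n even): Thorne 2017 Thm 5.1 = tree fact `Literature.NumberTheory.Automorphic.Thorne2017.automorphyLifting_unitary_ordinaryMinimal`, run over
the solvable layer M ⊇ K(ζ_ℓ)∩… of the hull where the extended-adequate layer J IS the residual image (Galois correspondence; M/K solvable, CM-ness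
preserved by choosing M inside a CM closure or replaced by Thorne's F = M·E), residual automorphy over M by solvable base change (Arthur–Clozel) of ρ',
descent M → K by the parent kit's CSD — the g11 TRANS pattern with SADQ ↦ SXADQ.  DARK on non-polarizable ρ (no unitary-type patching:
TwistedEndoscopySelfDual), non-ordinary or non-minimal local conditions (Thorne p2: «a theorem of minimal type»; p ∣ n kills Ihara-avoidance —
PatchingLocalComponentBarrier) and (ℓ, n) = (2, even) without strong residual oddness.  Plausibly true; size L. -/
theorem stub_rung_cm_thorne2017 : ∀ (K : Type) [Field K] [NumberField K] (n : ℕ) (hcpt : Literature.NumberTheory.Automorphic.isCompact_glFiniteIntegralLevel n K), 0 < n → Summit.Langlands.Langlands.Theorems.CoreAdequacy.LiftBelow n → ∀ (ℓ : ℕ) [Fact ℓ.Prime] (ι : PadicAlgCl ℓ ≃+* ℂ) (ρ : Literature.NumberTheory.GaloisRepresentations.FramedGaloisRep K (PadicAlgCl ℓ) n), ℓ < 2 * (n + 1) → NumberField.IsCMField K → Summit.Langlands.Langlands.Theorems.CoreAdequacy.CycIrr ρ → ¬ Summit.Langlands.Langlands.Theorems.CoreAdequacy.AdequateCyclotomicImage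 ρ → ¬ Summit.Langlands.Langlands.Theorems.CoreAdequacy.SolvablyAdequateImage ρ → ¬ Summit.Langlands.Langlands.Theorems.CoreAdequacy.LieDefect.SolvableDescentShadow ρ → ¬ Summit.Langlands.Langlands.Theorems.CoreAdequacy.LieDefect.SolvablyQuasiAdequateImage ρ → ℓ ≤ n → (∃ τ : Field.absoluteGaloisGroup (CyclotomicField ℓ K) →* Matrix.GeneralLinearGroup (Fin n) (Literature.NumberTheory.GaloisRepresentations.padicAlgClResidueField ℓ), (ρ.restrictField (CyclotomicField ℓ K)).IsReductionOf (RingHom.id (Literature.NumberTheory.GaloisRepresentations.padicAlgClResidueField ℓ)) τ ∧ Literature.NumberTheory.GaloisRepresentations.IsAbsIrreducible τ ∧ ∃ J : Subgroup (Matrix.GeneralLinearGroup (Fin n) (Literature.NumberTheory.GaloisRepresentations.padicAlgClResidueField ℓ)), Summit.Langlands.Langlands.Theorems.CoreAdequacy.LieDefect.AboveCore τ.range J ∧ J ≤ τ.range ∧ Literature.NumberTheory.GaloisRepresentations.IsAbsIrreducible J.subtype ∧ Literature.NumberTheory.GaloisRepresentations.Subgroup.IsExtendedAdequate J) → ¬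 Summit.Langlands.Langlands.Theorems.BrightMate.SolvablyReducible ρ → ¬ Summit.Langlands.Langlands.Theorems.BrightMate.SolvablyMated ι ρ → Summit.Langlands.Langlands.Theorems.CoreAdequacy.LiftTail K n hcpt ℓ ι ρ := by
  sorry

/-- REST stub: K neither CM nor (totally real with n ≤ 2).  Totally real K with n ≥ 3: in print only through a quadratic CM base change K·E/K
(E imaginary quadratic, disjoint from everything), the CM stub over K·E for the polarized part, and quadratic descent — plan, not theorem (polarization
over K·E of a non-self-dual ρ fails).  K neither totally real nor CM: no patching at all (TaylorWilesNumericalCoincidence: l₀ > 0; Calegari–Geraghty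
conditional) — dark exactly as AIL/LIE off CM/TR.  Genuine lemma of the line (the sector boundary of every known engine); size: open. -/
theorem stub_xs_rest : ∀ (K : Type) [Field K] [NumberField K] (n : ℕ) (hcpt : Literature.NumberTheory.Automorphic.isCompact_glFiniteIntegralLevel n K), 0 < n → Summit.Langlands.Langlands.Theorems.CoreAdequacy.LiftBelow n → ∀ (ℓ : ℕ) [Fact ℓ.Prime] (ι : PadicAlgCl ℓ ≃+* ℂ) (ρ : Literature.NumberTheory.GaloisRepresentations.FramedGaloisRep K (PadicAlgCl ℓ) n), ℓ < 2 * (n + 1) → ¬ NumberField.IsCMField K → ¬ (NumberField.IsTotallyReal K ∧ n ≤ 2) → Summit.Langlands.Langlands.Theorems.CoreAdequacy.CycIrr ρ → ¬ Summit.Langlands.Langlands.Theorems.CoreAdequacy.AdequateCyclotomicImage ρ → ¬ Summit.Langlands.Langlands.Theorems.CoreAdequacy.SolvablyAdequateImage ρ → ¬ Summit.Langlands.Langlands.Theorems.CoreAdequacy.LieDefect.SolvableDescentShadow ρ → ¬ Summit.Langlands.Langlands.Theorems.CoreAdequacy.LieDefect.SolvablyQuasiAdequateImage ρ → ℓ ≤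 n → (∃ τ : Field.absoluteGaloisGroup (CyclotomicField ℓ K) →* Matrix.GeneralLinearGroup (Fin n) (Literature.NumberTheory.GaloisRepresentations.padicAlgClResidueField ℓ), (ρ.restrictField (CyclotomicField ℓ K)).IsReductionOf (RingHom.id (Literature.NumberTheory.GaloisRepresentations.padicAlgClResidueField ℓ)) τ ∧ Literature.NumberTheory.GaloisRepresentations.IsAbsIrreducible τ ∧ ∃ J : Subgroup (Matrix.GeneralLinearGroup (Fin n) (Literature.NumberTheory.GaloisRepresentations.padicAlgClResidueField ℓ)), Summit.Langlands.Langlands.Theorems.CoreAdequacy.LieDefect.AboveCore τ.range J ∧ J ≤ τ.range ∧ Literature.NumberTheory.GaloisRepresentations.IsAbsIrreducible J.subtype ∧ Literature.NumberTheory.GaloisRepresentations.Subgroup.IsExtendedAdequate J) → ¬ Summit.Langlands.Langlands.Theorems.BrightMate.SolvablyReducible ρ → ¬ Summit.Langlands.Langlands.Theorems.BrightMate.SolvablyMated ι ρ → Summit.Langlands.Langlands.Theorems.CoreAdequacy.LiftTail K n hcpt ℓ ι ρ := by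
  sorry

/-- The split: RUNG_CM → RUNG_TR → REST → XS (case analysis on `NumberField.IsCMField K` and on `NumberField.IsTotallyReal K ∧ n ≤ 2`; no other content). -/
theorem ExtendedAdequateLayerLifting_of :
    (∀ (K : Type) [Field K] [NumberField K] (n : ℕ) (hcpt : Literature.NumberTheory.Automorphic.isCompact_glFiniteIntegralLevel n K), 0 < n → Summit.Langlands.Langlands.Theorems.CoreAdequacy.LiftBelow n → ∀ (ℓ : ℕ) [Fact ℓ.Prime] (ι : PadicAlgCl ℓ ≃+* ℂ) (ρ : Literature.NumberTheory.GaloisRepresentations.FramedGaloisRep K (PadicAlgCl ℓ) n), ℓ < 2 * (n + 1) → NumberField.IsCMField K → Summit.Langlands.Langlands.Theorems.CoreAdequacy.CycIrr ρ → ¬ Summit.Langlands.Langlands.Theorems.CoreAdequacy.AdequateCyclotomicImage ρ → ¬ Summit.Langlands.Langlands.Theorems.CoreAdequacy.SolvablyAdequateImage ρ → ¬ Summit.Langlands.Langlands.Theorems.CoreAdequacy.LieDefect.SolvableDescentShadow ρ → ¬ Summit.Langlands.Langlands.Theorems.CoreAdequacy.LieDefect.SolvablyQuasiAdequateImage ρ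 → ℓ ≤ n → (∃ τ : Field.absoluteGaloisGroup (CyclotomicField ℓ K) →* Matrix.GeneralLinearGroup (Fin n) (Literature.NumberTheory.GaloisRepresentations.padicAlgClResidueField ℓ), (ρ.restrictField (CyclotomicField ℓ K)).IsReductionOf (RingHom.id (Literature.NumberTheory.GaloisRepresentations.padicAlgClResidueField ℓ)) τ ∧ Literature.NumberTheory.GaloisRepresentations.IsAbsIrreducible τ ∧ ∃ J : Subgroup (Matrix.GeneralLinearGroup (Fin n) (Literature.NumberTheory.GaloisRepresentations.padicAlgClResidueField ℓ)), Summit.Langlands.Langlands.Theorems.CoreAdequacy.LieDefect.AboveCore τ.range J ∧ J ≤ τ.range ∧ Literature.NumberTheory.GaloisRepresentations.IsAbsIrreducible J.subtype ∧ Literature.NumberTheory.GaloisRepresentations.Subgroup.IsExtendedAdequate J) → ¬ Summit.Langlands.Langlands.Theorems.BrightMate.SolvablyReducible ρ → ¬ Summit.Langlands.Langlands.Theorems.BrightMate.SolvablyMated ι ρ → Summit.Langlands.Langlands.Theorems.CoreAdequacy.LiftTail K n hcpt ℓ ι ρ) →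
    (∀ (K : Type) [Field K] [NumberField K] (n : ℕ) (hcpt : Literature.NumberTheory.Automorphic.isCompact_glFiniteIntegralLevel n K), 0 < n → Summit.Langlands.Langlands.Theorems.CoreAdequacy.LiftBelow n → ∀ (ℓ : ℕ) [Fact ℓ.Prime] (ι : PadicAlgCl ℓ ≃+* ℂ) (ρ : Literature.NumberTheory.GaloisRepresentations.FramedGaloisRep K (PadicAlgCl ℓ) n), ℓ < 2 * (n + 1) → NumberField.IsTotallyReal K → n ≤ 2 → Summit.Langlands.Langlands.Theorems.CoreAdequacy.CycIrr ρ → ¬ Summit.Langlands.Langlands.Theorems.CoreAdequacy.AdequateCyclotomicImage ρ → ¬ Summit.Langlands.Langlands.Theorems.CoreAdequacy.SolvablyAdequateImage ρ → ¬ Summit.Langlands.Langlands.Theorems.CoreAdequacy.LieDefect.SolvableDescentShadow ρ → ¬ Summit.Langlands.Langlands.Theorems.CoreAdequacy.LieDefect.SolvablyQuasiAdequateImage ρ → ℓ ≤ n → (∃ τ : Field.absoluteGaloisGroup (CyclotomicField ℓ K) →* Matrix.GeneralLinearGroup (Fin n) (Literature.NumberTheory.GaloisRepresentations.padicAlgClResidueField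 ℓ), (ρ.restrictField (CyclotomicField ℓ K)).IsReductionOf (RingHom.id (Literature.NumberTheory.GaloisRepresentations.padicAlgClResidueField ℓ)) τ ∧ Literature.NumberTheory.GaloisRepresentations.IsAbsIrreducible τ ∧ ∃ J : Subgroup (Matrix.GeneralLinearGroup (Fin n) (Literature.NumberTheory.GaloisRepresentations.padicAlgClResidueField ℓ)), Summit.Langlands.Langlands.Theorems.CoreAdequacy.LieDefect.AboveCore τ.range J ∧ J ≤ τ.range ∧ Literature.NumberTheory.GaloisRepresentations.IsAbsIrreducible J.subtype ∧ Literature.NumberTheory.GaloisRepresentations.Subgroup.IsExtendedAdequate J) → ¬ Summit.Langlands.Langlands.Theorems.BrightMate.SolvablyReducible ρ → ¬ Summit.Langlands.Langlands.Theorems.BrightMate.SolvablyMated ι ρ → Summit.Langlands.Langlands.Theorems.CoreAdequacy.LiftTail K n hcpt ℓ ι ρ) →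
    (∀ (K : Type) [Field K] [NumberField K] (n : ℕ) (hcpt : Literature.NumberTheory.Automorphic.isCompact_glFiniteIntegralLevel n K), 0 < n → Summit.Langlands.Langlands.Theorems.CoreAdequacy.LiftBelow n → ∀ (ℓ : ℕ) [Fact ℓ.Prime] (ι : PadicAlgCl ℓ ≃+* ℂ) (ρ : Literature.NumberTheory.GaloisRepresentations.FramedGaloisRep K (PadicAlgCl ℓ) n), ℓ < 2 * (n + 1) → ¬ NumberField.IsCMField K → ¬ (NumberField.IsTotallyReal K ∧ n ≤ 2) → Summit.Langlands.Langlands.Theorems.CoreAdequacy.CycIrr ρ → ¬ Summit.Langlands.Langlands.Theorems.CoreAdequacy.AdequateCyclotomicImage ρ → ¬ Summit.Langlands.Langlands.Theorems.CoreAdequacy.SolvablyAdequateImage ρ → ¬ Summit.Langlands.Langlands.Theorems.CoreAdequacy.LieDefect.SolvableDescentShadow ρ → ¬ Summit.Langlands.Langlands.Theorems.CoreAdequacy.LieDefect.SolvablyQuasiAdequateImage ρ → ℓ ≤ n → (∃ τ : Field.absoluteGaloisGroup (CyclotomicField ℓ K) →* Matrix.GeneralLinearGroup (Fin n) (Literature.NumberTheory.GaloisRepresentations.padicAlgClResidueField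 ℓ), (ρ.restrictField (CyclotomicField ℓ K)).IsReductionOf (RingHom.id (Literature.NumberTheory.GaloisRepresentations.padicAlgClResidueField ℓ)) τ ∧ Literature.NumberTheory.GaloisRepresentations.IsAbsIrreducible τ ∧ ∃ J : Subgroup (Matrix.GeneralLinearGroup (Fin n) (Literature.NumberTheory.GaloisRepresentations.padicAlgClResidueField ℓ)), Summit.Langlands.Langlands.Theorems.CoreAdequacy.LieDefect.AboveCore τ.range J ∧ J ≤ τ.range ∧ Literature.NumberTheory.GaloisRepresentations.IsAbsIrreducible J.subtype ∧ Literature.NumberTheory.GaloisRepresentations.Subgroup.IsExtendedAdequate J) → ¬ Summit.Langlands.Langlands.Theorems.BrightMate.SolvablyReducible ρ → ¬ Summit.Langlands.Langlands.Theorems.BrightMate.SolvablyMated ι ρ → Summit.Langlands.Langlands.Theorems.CoreAdequacy.LiftTail K n hcpt ℓ ι ρ) →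
    ExtendedAdequateLayerLifting := by
  intro hC hT hR K _ _ n hcpt hn ih ℓ _ ι ρ hlt
  by_cases hCM : NumberField.IsCMField K
  · exact hC K n hcpt hn ih ℓ ι ρ hlt hCM
  · by_cases hTR : NumberField.IsTotallyReal K ∧ n ≤ 2
    · exact hT K n hcpt hn ih ℓ ι ρ hlt hTR.1 hTR.2
    · exact hR K n hcpt hn ih ℓ ι ρ hlt hCM hTR

/-- XS from its registered stubs (the form `ledger skeleton check` records). -/
theorem ExtendedAdequateLayerLifting_proof : Summit.Langlands.Langlands.Theses.ExtendedAdequacySplit.ExtendedAdequateLayerLifting :=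
  ExtendedAdequateLayerLifting_of stub_rung_cm_thorne2017 stub_rung_dyadicRank2_totallyReal stub_xs_rest

end Summit.Langlands.Langlands.Cruxes.ExtendedAdequateLayerLifting.Birth
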